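import Summits.CriticalPhenomena.CardyFormulaZ2.Theses.CardyWickAnisotropy
import Summits.CriticalPhenomena.CardyFormulaZ2.Theses.CardyMonotoneApproach
import Literature.Probability.Percolation.IsoradialRectangularCrossings
import Literature.Probability.Percolation.IsoradialRectangularCrossingsSS
import Literature.Probability.Percolation.IsoradialRectangularCrossingsOfSS
import Literature.Probability.Percolation.IsoradialRectangularCrossingsOfSSFact
import Literature.Probability.RandomPlanarGeometry.ConformalRectangleProofs
import Summits.CriticalPhenomena.CardyFormulaZ2.Theorems.CardyWickAnisotropyBoxFamilyToCardyKnownHalf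
import Summits.CriticalPhenomena.CardyFormulaZ2.Theorems.CardyWickAnisotropyBoxFamilyToCardyKnownHalfSS
import Summits.CriticalPhenomena.CardyFormulaZ2.Theorems.CardyWickAnisotropyBoxFamilyToCardyStubDomainContinuity
import Summits.CriticalPhenomena.CardyFormulaZ2.Theorems.CardyWickAnisotropyBoxFamilyToCardyStubRectilinearRealisation

/-!
# Birth skeleton (BC3) for crux `BoxFamilyToCardy` (stmt-CriticalPhenomena-14215) — lead c3 reshape

Route `CardyWickAnisotropy` (route-CriticalPhenomena-CardyWickAnisotropy), sub-problem
`CardyFormulaZ2`, crux (rank 4)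

  `BoxFamilyToCardy : AnisotropicBoxCardy → CardyFormulaZ2`

— from Cardy's value along the anisotropic self-dual box family (the route's target `X_A`: for
every `α ∈ (0,π)`, the `P_{𝕃(α)}`-probability of a left–right crossing of the lattice box
`[0,n+1]×[0,n]` tends to `Π_h(cot(α/2))`) to Cardy's formula for every conformal rectangle of
bond-`ℤ²` at `p = 1/2`.

## The line (known half ∘ conformal transport), state after lead c3's reshape (2026-08-17)

KNOWN HALF — LANDED modulo one printed statement. `stub_dkkmoThm21SS` is the named fact
`DKKMO2020_thm21_schrammSmirnov` (DKKMO 2020 = arXiv:2012.11672, Thm 2.1 at `q = 1`, Schramm–Smirnov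
half, AS PRINTED; `IsoradialRectangularCrossingsSS.lean`, p153623). From it the tree proves the per-quad
reading `DKKMO2020_thm21_quadCrossingProb` and Cor. 1.3 `dkkmo_crossing_rotation_invariance`
(`IsoradialRectangularCrossingsOfSS{,Fact}.lean`, p153853/p154258), and lead c1's glue
(p144386/p144530/p146175/p150338) gives `isotropicRectangles_of_thm21SS :
DKKMO2020_thm21_schrammSmirnov → AnisotropicBoxCardy → RectCardy` (p154554): Cardy for every
corner-marked axis-parallel rectangle of bond-`ℤ²`.

OPEN HALF — RESHAPED. Until lead c2 the open half was carried wholesale as the sibling crux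
`CardyMonotoneApproach.ConfInvTransport` (stmt-CriticalPhenomena-0794, conformal invariance of bond-`ℤ²`
crossing limits in transport form, Schramm ICM 2006 Problem 2.11). That crux now has a registered cut
(`Cruxes/ConfInvTransport/Lines/birth.lean`, planner-skel 2026-08-17) into three LIMIT-FREE stubs, and this
skeleton adopts exactly that cut — same stub NAMES and SIGNATURES, so that every stub landed for this crux
is at once the sibling's stub (found by `lean search`), and conversely:

* `stub_rectilinearInvariance` (S1, the HEART, open-problem class, held by the lead): for RECTILINEAR
  conformal rectangles `Q, Q'` (Jordan boundary inside finitely many axis-parallel segments) with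
  uniformizing data of equal cross-ratio, `P_δ(Q) − P_δ(Q') → 0` as `δ → 0⁺`
  (`P_δ = bondDomainCrossingProb · δ`). For THIS crux only the instance `Q` = a corner-marked rectangle
  is consumed, but the restriction is no easier, so the shared signature is kept.
* `stub_domainContinuity` (S2, L, RSW technology, provable in principle from the DISCHARGED
  Schramm–Smirnov Lemma 5.1): mesh-uniform continuity of `P_δ` in the marked-loop topology.
* `stub_rectilinearRealisation` (S3, M–L, pure conformal geometry, provable now from
  `exists_rectilinear_close` + Radó `tendsto_crossRatio_of_tendsto_mark` + five-point uniformization):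
  exact-modulus rectilinear approximants.

ASSEMBLY `BoxFamilyToCardy_of` (real proof over tree theorems): `confInvTransport_of_rectilinear`
(S1+S2+S3 ⇒ `ConfInvTransport`, the sibling skeleton's four-corner argument `tendsto_of_approximants`,
adapted verbatim from `Cruxes/ConfInvTransport/Lines/birth.lean`) fed into lead c2's landed
`boxFamilyToCardy_of_thm21SS_of_confInvTransport`.

No new definitions (two reducible `Registered.stub_*` aliases key the open stub statements by name for the
skeleton audit); sorries ONLY inside the two open `stub_*` (S2, S3 landed in wave 1 of lead c3).
-/

noncomputable section

open Filter Topology Set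
open UpperHalfPlane (upperHalfPlaneSet)
open Literature.Probability.RandomPlanarGeometry
open Literature.Probability.Percolation (bondDomainCrossingProb DKKMO2020_thm21_quadCrossingProb
  DKKMO2020_thm21_schrammSmirnov)
open Summit.CriticalPhenomena.CardyFormulaZ2.Theses.CardyWickAnisotropy (AnisotropicBoxCardy
  BoxFamilyToCardy)
open Summit.CriticalPhenomena.CardyFormulaZ2.Theses.CardyMonotoneApproach (RectCardy ConfInvTransport)

namespace Summit.CriticalPhenomena.CardyFormulaZ2.Cruxes.BoxFamilyToCardy.Birth

/-! ## Stubs -/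

/-- **Stub 1 (known, in print; XL to formalise)** — DKKMO 2020, Theorem 2.1 at `q = 1`,
Schramm–Smirnov (`d_SS`) half, AS PRINTED (arXiv:2012.11672v1 p. 7: "for every `δ < δ₀` and
`α ∈ (ε, π−ε)` there exists a coupling `P_{α,δ,ε}` between `ω ∼ φ_{δ𝕃(α)}` and `ω' ∼ φ_{δ𝕃(π/2)}`
such that … `P[d_SS(ω, ω') > ε] < ε`"), in the tree's metric-free rendering on Schramm–Smirnov's
space `ℋ_ℂ` (open neighbourhoods of the diagonal; `ℋ_ℂ` is compact metrizable, so this is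
equivalent to the printed form for any compatible metric — both directions proved in
`IsoradialRectangularCrossingsSS.lean`, p153623). The tree's named fact
`Literature.Probability.Percolation.DKKMO2020_thm21_schrammSmirnov` (no `_holds` theorem: this is
the body of DKKMO's paper, the route's needs-fact debt). The per-quad reading
`DKKMO2020_thm21_quadCrossingProb` and Cor. 1.3 are THEOREMS modulo this one
(`IsoradialRectangularCrossingsOfSS{,Fact}.lean`, p153853/p154258).
[cite: DKKMO2020Rotational, Thm 2.1 (q = 1, d_SS part)] -/
theorem stub_dkkmoThm21SS : DKKMO2020_thm21_schrammSmirnov := by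
  sorry

/-- The per-quad reading of Theorem 2.1 from the printed coupling statement (tree theorem
`DKKMO2020_thm21_quadCrossingProb_of_thm21_schrammSmirnov`, by name). -/
theorem thm21_quadCrossingProb_of_stub (h : DKKMO2020_thm21_schrammSmirnov) :
    DKKMO2020_thm21_quadCrossingProb :=
  Literature.Probability.Percolation.DKKMO2020_thm21_quadCrossingProb_of_thm21_schrammSmirnov h

/-- **Stub S1 `stub_rectilinearInvariance` (the HEART; open-problem class, size XL)** — verbatim the
stub registered on the sibling crux stmt-CriticalPhenomena-0794. If `Q`, `Q'` are rectilinear conformal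
rectangles (Jordan boundary inside finitely many axis-parallel segments) with uniformizing data
`(ψ, y)`, `(ψ', y')` of equal Cardy cross-ratio, then the bond-`ℤ²` crossing probabilities are
asymptotically equal: `bondDomainCrossingProb Q δ - bondDomainCrossingProb Q' δ → 0` as `δ → 0⁺`.
Why plausibly true: implied by the conjunct (both sides tend to `F(η)`); the exact analogue, for
conformal self-maps of the rectilinear class, of DKKMO's limit-free rotation statement
(arXiv:2012.11672 Thm 1.2). Why open: it IS conformal invariance of bond-`ℤ²` crossing probabilities
(Schramm2007ICM Problem 2.11) on a subclass; no embedding-blind proof exists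
(`Literature.Barriers.CriticalPhenomena.EmbeddingModulusUniqueness`, Beffara2008Universal Prop. 4).
This crux consumes only the instance `Q` = corner-marked axis-parallel rectangle (where `RectCardy`
supplies the limit), `Q'` = rectilinear approximant of an arbitrary conformal rectangle.
[cite: Schramm2007ICM, §2.6 Problem 2.11] [cite: DKKMO2020Rotational, Thm 1.2]
[cite: Beffara2008Universal, Prop. 4] -/
theorem stub_rectilinearInvariance :
    ∀ (Q Q' : Literature.Probability.RandomPlanarGeometry.ConformalRectangle), (∃ S : Finset (ℂ × ℂ), (∀ p ∈ S, p.1.re = p.2.re ∨ p.1.im = p.2.im) ∧ frontier Q.carrier ⊆ ⋃ p ∈ S, segment ℝ p.1 p.2) → (∃ S : Finset (ℂ × ℂ), (∀ p ∈ S, p.1.re = p.2.re ∨ p.1.im = p.2.im) ∧ frontier Q'.carrier ⊆ ⋃ p ∈ S, segment ℝ p.1 p.2) → ∀ (ψ : Literature.Probability.RandomPlanarGeometry.ConformalEquiv UpperHalfPlane.upperHalfPlaneSet Q.carrier) (y : Fin 4 → ℝ) (ψ' : Literature.Probability.RandomPlanarGeometry.ConformalEquiv UpperHalfPlane.upperHalfPlaneSet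 Q'.carrier) (y' : Fin 4 → ℝ), Q.IsUniformizing ψ y → Q'.IsUniformizing ψ' y' → Literature.Probability.RandomPlanarGeometry.crossRatio y = Literature.Probability.RandomPlanarGeometry.crossRatio y' → Filter.Tendsto (fun δ : ℝ ↦ Literature.Probability.Percolation.bondDomainCrossingProb Q δ - Literature.Probability.Percolation.bondDomainCrossingProb Q' δ) (nhdsWithin (0 : ℝ) (Set.Ioi 0)) (nhds 0) := by
  sorry

/-! ### Stubs S2, S3: LANDED (wave 1 of lead c3, 2026-08-17) — imported from the tree

* `stub_domainContinuity` (S2) — `Theorems/CardyWickAnisotropyBoxFamilyToCardyStubDomainContinuity.lean`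
  (p158922; parts p158118 `…Part1` (closeness scale, dog-on-leash converse, upper inclusion),
  p158259 `…Part2` (Bollobás–Riordan Claim-19 bond port with explicit margin), p158718 `…Part3`
  (lower inclusion)): the cross-domain Schramm–Smirnov (5.1) squeeze;
* `stub_rectilinearRealisation` (S3) — `Theorems/CardyWickAnisotropyBoxFamilyToCardyStubRectilinearRealisation.lean`
  (p157265): `exists_rectilinear_close` + Radó twice + five-point uniformization + IVT.
Both are theorems of this namespace now (same names, same signatures as registered), and serve the
sibling crux stmt-CriticalPhenomena-0794 verbatim.

## Name-keyed aliases of the two OPEN stub statements (the hypotheses of the composition)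

The skeleton audit (`#h21_check_skeleton`, HarnessLib/Audit/Check.lean) admits as hypotheses of the
composition exactly the registered obligations and the declared stubs BY NAME; these reducible aliases
key each stub statement by its stub name (pattern of `Cruxes/StripClusterRates/Lines/…`). -/
namespace Registered

/-- Alias of the statement of `stub_dkkmoThm21SS` (= the named fact
`DKKMO2020_thm21_schrammSmirnov`), keyed by the stub name. -/
abbrev stub_dkkmoThm21SS : Prop := DKKMO2020_thm21_schrammSmirnov

/-- Alias of the statement of `stub_rectilinearInvariance` (S1), verbatim, keyed by the stub name. -/
abbrev stub_rectilinearInvariance : Prop :=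
  ∀ (Q Q' : Literature.Probability.RandomPlanarGeometry.ConformalRectangle), (∃ S : Finset (ℂ × ℂ), (∀ p ∈ S, p.1.re = p.2.re ∨ p.1.im = p.2.im) ∧ frontier Q.carrier ⊆ ⋃ p ∈ S, segment ℝ p.1 p.2) → (∃ S : Finset (ℂ × ℂ), (∀ p ∈ S, p.1.re = p.2.re ∨ p.1.im = p.2.im) ∧ frontier Q'.carrier ⊆ ⋃ p ∈ S, segment ℝ p.1 p.2) → ∀ (ψ : Literature.Probability.RandomPlanarGeometry.ConformalEquiv UpperHalfPlane.upperHalfPlaneSet Q.carrier) (y : Fin 4 → ℝ) (ψ' : Literature.Probability.RandomPlanarGeometry.ConformalEquiv UpperHalfPlane.upperHalfPlaneSet Q'.carrier) (y' : Fin 4 → ℝ), Q.IsUniformizing ψ y → Q'.IsUniformizing ψ' y' → Literature.Probability.RandomPlanarGeometry.crossRatio y = Literature.Probability.RandomPlanarGeometry.crossRatio y' → Filter.Tendsto (fun δ : ℝ ↦ Literature.Probability.Percolation.bondDomainCrossingProb Q δ - Literature.Probability.Percolation.bondDomainCrossingProb Q' δ) (nhdsWithin (0 : ℝ) (Set.Ioi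 0)) (nhds 0)

end Registered

/-- Consistency: each alias IS its stub (definitionally) — the two open stubs inhabit the aliases;
the two landed ones are tree theorems (`stub_domainContinuity`, `stub_rectilinearRealisation`). -/
theorem registered_of_stubs :
    Registered.stub_dkkmoThm21SS ∧ Registered.stub_rectilinearInvariance :=
  ⟨stub_dkkmoThm21SS, stub_rectilinearInvariance⟩

/-! ## The transport: S1 (+ the landed S2, S3) ⇒ `ConfInvTransport`

Also LANDED as `Theorems/CardyWickAnisotropyBoxFamilyToCardyTransport.lean` (p159480/p160317:
`tendsto_of_approximants`, `confInvTransport_of_rectilinearInvariance : S1 → ConfInvTransport`,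
`boxFamilyToCardy_of_thm21SS_of_rectilinearInvariance : thm21SS → S1 → BoxFamilyToCardy`,
`cardyFormulaZ2_of_rectilinearInvariance_of_rectCardy : S1 → RectCardy → CardyFormulaZ2`); re-proved
here (private bookkeeping lemma) so that the skeleton does not depend on that module. -/

/-- Four-corner transport of a limit (private copy of the landed `tendsto_of_approximants`): if for
every `τ > 0` there are `a, a'` eventually `τ`-close to `p, p'` with `a - a' → 0`, then
`p → L ⇒ p' → L`. [folklore] -/
private theorem tendsto_of_approximants_aux {l : Filter ℝ} {p p' : ℝ → ℝ} {L : ℝ}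
    (h : ∀ τ : ℝ, 0 < τ → ∃ a a' : ℝ → ℝ, (∀ᶠ δ in l, |a δ - p δ| ≤ τ) ∧
      (∀ᶠ δ in l, |a' δ - p' δ| ≤ τ) ∧ Tendsto (fun δ ↦ a δ - a' δ) l (𝓝 0))
    (hp : Tendsto p l (𝓝 L)) : Tendsto p' l (𝓝 L) := by
  rw [Metric.tendsto_nhds]
  intro τ hτ
  have hτ4 : 0 < τ / 4 := by positivity
  obtain ⟨a, a', ha, ha', haa'⟩ := h (τ / 4) hτ4
  have h3 : ∀ᶠ δ in l, dist (a δ - a' δ) 0 < τ / 4 := Metric.tendsto_nhds.1 haa' _ hτ4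
  have h4 : ∀ᶠ δ in l, dist (p δ) L < τ / 4 := Metric.tendsto_nhds.1 hp _ hτ4
  filter_upwards [ha, ha', h3, h4] with δ h1 h2 h3 h4
  rw [Real.dist_eq, sub_zero] at h3
  rw [Real.dist_eq] at h4 ⊢
  obtain ⟨h1l, h1r⟩ := abs_le.1 h1
  obtain ⟨h2l, h2r⟩ := abs_le.1 h2
  obtain ⟨h3l, h3r⟩ := abs_lt.1 h3
  obtain ⟨h4l, h4r⟩ := abs_lt.1 h4
  exact abs_lt.2 ⟨by linarith, by linarith⟩

/-- **`ConfInvTransport` (the `CardyMonotoneApproach` copy, stmt-CriticalPhenomena-0794, by name) from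
S1 ALONE**, keyed by the stub name: for `R, R'` of common modulus `η` with `P_δ(R) → L` and `τ > 0`,
the landed S2 (`stub_domainContinuity`) gives closeness scales at `R`, `R'`, the landed S3
(`stub_rectilinearRealisation`) gives rectilinear `Q`, `Q'` that close, both of modulus exactly `η`,
S1 gives `P_δ(Q) - P_δ(Q') → 0`, and the four-corner lemma transports the limit (the landed
`confInvTransport_of_rectilinearInvariance`, p159480). [folklore] -/
theorem confInvTransport_of_rectilinear (h₁ : Registered.stub_rectilinearInvariance) :
    ConfInvTransport := by
  intro R R' φ x φ' x' huni huni' hη L hL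
  refine tendsto_of_approximants_aux (fun τ hτ ↦ ?_) hL
  obtain ⟨ε₀, hε₀, hcont⟩ := stub_domainContinuity R τ hτ
  obtain ⟨ε₀', hε₀', hcont'⟩ := stub_domainContinuity R' τ hτ
  obtain ⟨Q, ψ, y, hQrect, hQuni, hQloop, hQmark, hQη⟩ :=
    stub_rectilinearRealisation R φ x huni ε₀ hε₀
  obtain ⟨Q', ψ', y', hQ'rect, hQ'uni, hQ'loop, hQ'mark, hQ'η⟩ :=
    stub_rectilinearRealisation R' φ' x' huni' ε₀' hε₀'
  have hyy' : crossRatio y = crossRatio y' := by rw [hQη, hQ'η, hη]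
  exact ⟨bondDomainCrossingProb Q, bondDomainCrossingProb Q', hcont Q hQloop hQmark,
    hcont' Q' hQ'loop hQ'mark, h₁ Q Q' hQrect hQ'rect ψ y ψ' y' hQuni hQ'uni hyy'⟩

/-! ## The composition: the two open stubs (and the two landed ones) imply the crux BY NAME -/

/-- **`BoxFamilyToCardy` from the stubs.** The printed DKKMO Thm 2.1 (`d_SS` half, stub 1) gives,
through the landed known half (`isotropicRectangles_of_thm21SS`, p154554), Cardy for every
corner-marked axis-parallel rectangle of bond-`ℤ²` from the route's target `AnisotropicBoxCardy`; the
heart S1 with the landed S2, S3 gives `ConfInvTransport` (`confInvTransport_of_rectilinear`; landed as `confInvTransport_of_rectilinearInvariance`, p159480); lead c2's landed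
`boxFamilyToCardy_of_thm21SS_of_confInvTransport` (realise every modulus by a corner-marked
rectangle, `exists_rect_datum_of_mem_Ioo`, read Cardy there, transport) concludes the crux. -/
theorem BoxFamilyToCardy_of (hSS : Registered.stub_dkkmoThm21SS)
    (h₁ : Registered.stub_rectilinearInvariance) : BoxFamilyToCardy :=
  boxFamilyToCardy_of_thm21SS_of_confInvTransport hSS (confInvTransport_of_rectilinear h₁)

end Summit.CriticalPhenomena.CardyFormulaZ2.Cruxes.BoxFamilyToCardy.Birth

end
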